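import Mathlib
import Literature.MathematicalPhysics.QuantumFieldTheory.Balaban1983to89.B6QGGQInvTowerTorus
import Literature.MathematicalPhysics.QuantumFieldTheory.Balaban1983to89.B6Ineq288Edge

/-!
# `Balaban1983to89.B6QGQCoerciveTowerTorus` — T. Bałaban, *Propagators and renormalization transformations for lattice gauge
theories. II*, Commun. Math. Phys. **96** (1984) 223–250 [Balaban1984PropagatorsII], Proposition 2.3 p. 238 with p. 235, and [4] = *… I*,
CMP **95** (1984) p. 25: **PROPOSITION 2.3 VERBATIM (`B6.Prop23Printed`) ON THE ONE-SCALE TOWER-TORUS FAMILY FOR THE GENUINE KERNEL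
`(Q′_KG′_K²Q′_K*)⁻¹(y,y′)`, WITH NO HYPOTHESIS** — the single displayed input left by `B6QGGQInvTowerTorus` (this seat, p261936), a K- and
volume-uniform lower bound `Q′_KG′_KQ′_K* ≥ γ`, is PROVED here WITHOUT Fourier analysis, by the variational principle
(`QGQInverse.qgq_coercive_of_approx_right_inverse`) with an EXACT bump right inverse of `Q′_K`; hence **Lemma 2.1 ∧ Prop 2.2 ∧ Prop 2.3, all
three verbatim census Props with genuine operators on ONE family, hypothesis-free**, and the (2.88) edge
`B6Ineq288Edge.ineq288_of_printed_lemma21` instantiates non-vacuously (closing `example`)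

statement-level skeleton of published theorems with citation tags; proofs where landed; nothing here is a claim about the Yang–Mills mass gap.
PDF held: `paper:balaban1984-cmp96-propagators-rt-ii` (journal page = PDF page + 222); pp. 235, 238 [PDF 13, 16] read this lineage.

CITATION HEADER (cell `lit-balaban`, HOME `run/shared/lean/pub/lit-balaban/`; Phase-2 proof seat `p01` gen 6 = unit `lit-balaban-p01`;
`PHASE2-TARGETS.md` §G, G.5-34(d)).  SKELETON row **`B6.Prop2.3`** of `HOME/lit-balaban-r03/ROWS-B6.md` (owner r03, referee ref-4), kind
«model instance» on the tower carriers `Site P K`/`Site P 0` (gen-5's p253194 inhabits the same Prop on the `B5QGGQ145` carriers by the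
Fourier route; here the family is the one where Lemma 2.1 (p260319) and Prop 2.2 (p258648) are genuine too — owner's suggestion
07:30:20Z).  IMPORTED, NOT MODIFIED: `…B6QGGQInvTowerTorus` (this seat: `qggqK`, `cinvK`, `deltaPrimeK`, `Qk_eq_smul_transpose`, `wQ`,
`coercive_qggqK_of_qgqK`, `prop23Printed_towerTorus_of_coercive_qgq`), `…QGQInverse` (r1: `Coercive`, `qgq_coercive_of_approx_right_inverse`),
`…B1RG242Torus` (`Site.fibreEquiv`, `Site.card_fibre`, `Qk_mulVec`, `Qks_mulVec`, `form_hOp`, `form_hOp_nonneg`, `deriv_mulVec`, `QkQks`),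
`…B1` (`aSeq_le`, `aSeq_pos`), `…B6Lemma21TowerTorus`, `…B6Prop22OneScaleTorus`, `…B6Ineq288Edge` (the edge, for the closing `example`).

WHAT THE PAPER PRINTS.  B6 p. 235 [PDF 13]: *"Of course the operator Q′G′²Q′* is positive definite, so its inverse is well defined. We will
construct it and investigate its properties using again a random walk expansion. Our considerations are analogous to Sect. 5 of [3],
concerning unit lattice operators. If we have one scale, i.e. Λ_k = T₁^{(k)}, then the operator is a unit lattice operator."*; Prop. 2.3
(2.87) p. 238 (verbatim = docstring of `B6.Prop23Printed`); [4] p. 25 (after (1.44)): *"It is enough to prove that Q′_kG′_k²Q′_k* is positive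
definite"*; [3] Sect. 5 (5.6) *"A ≥ γ₀I"*.  The print obtains positivity spectrally; THIS FILE'S ROUTE (bump test field + variational lower
bound + Cauchy–Schwarz + [3] Sect. 5) is the cell's written-repair route (`QGQInverse` §5a–5d), not the printed one — recorded as such.

WHAT IS PROVED HERE (0 `sorry`, 0 named facts; axioms standard).  `n = L^K`, `w = L^{−Kd}`, volume `P` with `K ≥ 1`, `a > 0`, `m² ≥ 0`.
* §1 the profile `β(r) = (r+1)(n−r)`, `Σ_{r<n}β = n(n+1)(n+2)/6`, `β̃ = nβ/Σβ`: `sum_bumpN` (`Σβ̃ = n`), `bumpN_le` (`≤ 3/2`), `bumpN_zero_le`/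
  `bumpN_last_le` (`≤ 6/n` at the ends), `abs_bumpN_step_le` (`|β̃((r+1) mod n) − β̃(r)| ≤ 6/n`).
* §2 in-block coordinates `rc x μ = x_μ mod n` on `Site P 0` and the unit shift: `rc_shift_self` (`r_μ(x+e_μ) = (r_μ(x)+1) mod n`),
  `proj_shift_of_lt` (interior step keeps the block), `rc_shift_eq_zero` (face step), `proj_shift_or`, `shiftEquiv` (shift invariance of sums).
* §3 the block bump `bump x = Π_μ β̃(r_μ(x))`: `bump_le` (`≤ (3/2)^d`), `abs_bump_shift_sub_le` (`≤ (6/n)(3/2)^d`), `bump_shift_face_le`;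
  `sum_block_prod` (block sums factorise through `Site.fibreEquiv`), **`sum_block_bump`** (`Σ_{B^K(y)} b = n^d`), the test map
  `testT λ x = λ(y(x))·b(x)` and **`Qk_testT : Q_K(Tλ) = λ`** (EXACT right inverse).
* §4 `N0 λ = Σ_x λ(y(x))² = n^d‖λ‖²` (`N0_eq`), `testT_dot_self_le` (`‖Tλ‖² ≤ (3/2)^{2d}N₀`), `abs_testT_shift_sub_le`, **`deriv_testT_sq_le`**
  (`‖∂^ε_μTλ‖² ≤ 360(3/2)^{2d}N₀` — `ε⁻¹ = n` against the `6/n` of the profile), `testT_QksQk_le`, **`energy_le`**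
  (`⟨Tλ, Δ′Tλ⟩ ≤ C_q·N₀`, `C_q = m²(3/2)^{2d} + 360d(3/2)^{2d} + a(3/2)^d`, using `a_K ≤ a`), `form_deltaPrimeK_nonneg`.
* §5 **`coercive_qgq`** (`Q′_KG′_KQ′_K* ≥ 1/C_q` on every volume), **`coercive_qgq_family`** (uniform on `Index d L`),
  **`prop23Printed_towerTorus`** — `B6.Prop23Printed d (oneScaleGeo-family) (cinvK-family)` with NO hypothesis —,
  **`lemma21_prop22_prop23_towerTorus`** (Lemma 2.1 ∧ Prop 2.2 ∧ Prop 2.3, genuine, one family, hypothesis-free), and the closing `example`: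
  `B6Ineq288Edge.ineq288_of_printed_lemma21` applied to the three — (2.88) on the family, non-vacuously.
HONEST SCOPE.  One scale (one zone; (2.1)–(2.2) void), scalar model, `m² ≥ 0`, `a > 0` (print: m² = 0, a = 1); constants existential but
uniform in the volume, in K ≥ 1, Mb, R; the coercivity route is variational (not the printed Fourier argument).  NOT the multi-scale statement,
NOT summit progress.
-/

namespace Literature.MathematicalPhysics.QuantumFieldTheory.Balaban1983to89.B6QGQCoerciveTowerTorus

open Finset Matrix
open B1RG242Torus (tower Qk Qks hOp avgMat extMat lvl QkQks lvl_of_le sitesPerDir_zero_eq deriv form_hOp form_hOp_nonneg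
  deriv_mulVec)
open B6QGGQInvTowerTorus (wQ wQ_pos Qk_eq_smul_transpose deltaPrimeK deltaPrimeK_transpose deltaPrimeK_isUnit G_eq_inv
  coercive_qggqK_of_qgqK prop23Printed_towerTorus_of_coercive_qgq cinvK qggqK)
open B6Prop22OneScaleTorus (oneScaleGeo torusGp Index prop22Printed_oneScaleTorus)
open B6Lemma21TowerTorus (lemma21Printed_towerTorus)
open QGQInverse (Coercive qgq_coercive_of_approx_right_inverse)

noncomputable section

/-! ## §1. The one-dimensional profile `β(r) = (r+1)(n−r)` on `{0,…,n−1}` and its normalisation `β̃ = nβ/Σβ` -/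

section Profile

/-- `β(r) = (r + 1)(n − r)`: a discrete bump on `{0, …, n − 1}`, symmetric, `β(0) = β(n−1) = n`, maximal `≈ n²/4` in the middle.
[cite: Balaban1984PropagatorsI, p.25 (after (1.44), the positivity of Q′G′Q′*); bookkeeping] -/
def bumpβ (n : ℕ) (r : ℕ) : ℝ := ((r : ℝ) + 1) * ((n : ℝ) - r)

/-- `Σ_{r<n} β(r) = n(n+1)(n+2)/6`. [folklore] -/
private theorem sum_bumpβ (n : ℕ) : ∑ r ∈ Finset.range n, bumpβ n r = (n : ℝ) * ((n : ℝ) + 1) * ((n : ℝ) + 2) / 6 := by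
  have key : ∀ m : ℕ, ∑ r ∈ Finset.range m, ((r : ℝ) + 1) * ((m : ℝ) - r) = (m : ℝ) * ((m : ℝ) + 1) * ((m : ℝ) + 2) / 6 := by
    intro m
    induction m with
    | zero => simp
    | succ m ih =>
      have hsplit : ∀ r : ℕ, ((r : ℝ) + 1) * (((m + 1 : ℕ) : ℝ) - r) = ((r : ℝ) + 1) * ((m : ℝ) - r) + ((r : ℝ) + 1) := by
        intro r; push_cast; ring
      simp_rw [hsplit]
      rw [Finset.sum_add_distrib, Finset.sum_range_succ, Finset.sum_range_succ, ih]
      have hid : ∑ r ∈ Finset.range m, ((r : ℝ) + 1) = (m : ℝ) * ((m : ℝ) + 1) / 2 := by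
        have h2 := Finset.sum_range_id_mul_two (m + 1)
        have h3 : ∑ r ∈ Finset.range m, ((r : ℝ) + 1) = ∑ r ∈ Finset.range (m + 1), (r : ℝ) := by
          rw [Finset.sum_range_succ']
          simp
        rw [h3]
        have h4 : ((∑ i ∈ Finset.range (m + 1), i : ℕ) : ℝ) * 2 = ((m + 1 : ℕ) : ℝ) * ((m + 1 - 1 : ℕ) : ℝ) := by
          exact_mod_cast h2
        rw [Nat.add_sub_cancel] at h4
        push_cast at h4 ⊢
        linarith
      rw [hid]
      push_cast
      ring
  exact key n

/-- the normalising sum `S = Σ_{r<n} β(r)`. [folklore] -/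
def bumpS (n : ℕ) : ℝ := ∑ r ∈ Finset.range n, bumpβ n r

/-- **The normalised profile `β̃(r) = n·β(r)/S`**, so that `Σ_{r<n} β̃(r) = n`. [cite: Balaban1984PropagatorsI, p.25; bookkeeping] -/
def bumpN (n : ℕ) (r : ℕ) : ℝ := (n : ℝ) * bumpβ n r / bumpS n

variable {n : ℕ}

/-- closed form of the normalising sum. [folklore] -/
private theorem bumpS_eq (n : ℕ) : bumpS n = (n : ℝ) * ((n : ℝ) + 1) * ((n : ℝ) + 2) / 6 := sum_bumpβ n

/-- the normalising sum is positive. [folklore] -/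
private theorem bumpS_pos (hn : 1 ≤ n) : 0 < bumpS n := by
  rw [bumpS_eq]
  have : (1 : ℝ) ≤ n := by exact_mod_cast hn
  positivity

/-- closed form `β̃(r) = 6(r+1)(n−r)/((n+1)(n+2))`. [folklore] -/
private theorem bumpN_eq (hn : 1 ≤ n) (r : ℕ) :
    bumpN n r = 6 * (((r : ℝ) + 1) * ((n : ℝ) - r)) / (((n : ℝ) + 1) * ((n : ℝ) + 2)) := by
  unfold bumpN
  rw [bumpS_eq, bumpβ]
  have h1 : (0 : ℝ) < n := by exact_mod_cast hn
  field_simp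

/-- **`Σ_{r<n} β̃(r) = n`** (exact normalisation). [cite: Balaban1984PropagatorsI, p.25; bookkeeping] -/
theorem sum_bumpN (hn : 1 ≤ n) : ∑ r ∈ Finset.range n, bumpN n r = n := by
  unfold bumpN
  rw [← Finset.sum_div, ← Finset.mul_sum]
  exact (div_eq_iff (bumpS_pos hn).ne').mpr (by unfold bumpS; ring)

/-- `0 ≤ β̃(r)` for `r < n`. [cite: Balaban1984PropagatorsI, p.25 (positivity of Q′G′Q′*); bookkeeping] -/
theorem bumpN_nonneg (hn : 1 ≤ n) {r : ℕ} (hr : r < n) : 0 ≤ bumpN n r := by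
  rw [bumpN_eq hn]
  have : (r : ℝ) + 1 ≤ n := by exact_mod_cast hr
  have : (0 : ℝ) ≤ (n : ℝ) - r := by linarith
  positivity

/-- **`β̃(r) ≤ 3/2`** (`4(r+1)(n−r) ≤ (n+1)²`). [cite: Balaban1984PropagatorsI, p.25; bookkeeping] -/
theorem bumpN_le (hn : 1 ≤ n) (r : ℕ) : bumpN n r ≤ 3 / 2 := by
  rw [bumpN_eq hn]
  have h1 : (1 : ℝ) ≤ n := by exact_mod_cast hn
  have hamgm : 4 * (((r : ℝ) + 1) * ((n : ℝ) - r)) ≤ ((n : ℝ) + 1) ^ 2 := by nlinarith [sq_nonneg ((n : ℝ) - 2 * r - 1)]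
  rw [div_le_iff₀ (by positivity)]
  nlinarith

/-- **`β̃(0) ≤ 6/n`**, **`β̃(n−1) ≤ 6/n`** (the profile is small at the two ends of the block). [cite: Balaban1984PropagatorsI, p.25; bookkeeping] -/
theorem bumpN_zero_le (hn : 1 ≤ n) : bumpN n 0 ≤ 6 / n := by
  rw [bumpN_eq hn]
  have h1 : (1 : ℝ) ≤ n := by exact_mod_cast hn
  rw [div_le_div_iff₀ (by positivity) (by positivity), Nat.cast_zero, zero_add, sub_zero, one_mul]
  nlinarith

/-- `β̃(n−1) ≤ 6/n`. [cite: Balaban1984PropagatorsI, p.25 (positivity of Q′G′Q′*); bookkeeping] -/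
theorem bumpN_last_le (hn : 1 ≤ n) : bumpN n (n - 1) ≤ 6 / n := by
  rw [bumpN_eq hn]
  have h1 : (1 : ℝ) ≤ n := by exact_mod_cast hn
  have hc : (((n - 1 : ℕ) : ℝ)) = (n : ℝ) - 1 := by rw [Nat.cast_sub hn, Nat.cast_one]
  rw [hc, div_le_div_iff₀ (by positivity) (by positivity)]
  nlinarith

/-- **`|β̃(r+1) − β̃(r)| ≤ 6/n`** for `r + 1 < n` (the profile is `6/n`-Lipschitz per lattice step). [cite: Balaban1984PropagatorsI, p.25; bookkeeping] -/
theorem abs_bumpN_succ_sub_le (hn : 1 ≤ n) {r : ℕ} (hr : r + 1 < n) : |bumpN n (r + 1) - bumpN n r| ≤ 6 / n := by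
  rw [bumpN_eq hn, bumpN_eq hn]
  have h1 : (1 : ℝ) ≤ n := by exact_mod_cast hn
  have hr' : (r : ℝ) + 2 ≤ n := by exact_mod_cast hr
  have hpos : (0 : ℝ) < ((n : ℝ) + 1) * ((n : ℝ) + 2) := by positivity
  have e : 6 * ((((r + 1 : ℕ) : ℝ) + 1) * ((n : ℝ) - ((r + 1 : ℕ) : ℝ))) / (((n : ℝ) + 1) * ((n : ℝ) + 2)) -
      6 * (((r : ℝ) + 1) * ((n : ℝ) - r)) / (((n : ℝ) + 1) * ((n : ℝ) + 2)) =
      6 * ((n : ℝ) - 2 * r - 2) / (((n : ℝ) + 1) * ((n : ℝ) + 2)) := by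
    push_cast; field_simp; ring
  rw [e, abs_div, abs_of_pos hpos, div_le_div_iff₀ hpos (by positivity)]
  have hr0 : (0 : ℝ) ≤ r := Nat.cast_nonneg r
  have hab : |6 * ((n : ℝ) - 2 * r - 2)| ≤ 6 * n := by
    rw [abs_le]; constructor <;> nlinarith
  calc |6 * ((n : ℝ) - 2 * r - 2)| * n ≤ 6 * n * n := mul_le_mul_of_nonneg_right hab (by positivity)
    _ ≤ 6 * (((n : ℝ) + 1) * ((n : ℝ) + 2)) := by nlinarith

/-- the wrapped step: `|β̃((r+1) mod n) − β̃(r)| ≤ 6/n` for all `r < n` (at `r = n−1` both ends are `≤ 6/n`). [cite: Balaban1984PropagatorsI, p.25 (positivity of Q′G′Q′*); bookkeeping] -/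
theorem abs_bumpN_step_le (hn : 1 ≤ n) {r : ℕ} (hr : r < n) : |bumpN n ((r + 1) % n) - bumpN n r| ≤ 6 / n := by
  rcases Nat.lt_or_ge (r + 1) n with h | h
  · rw [Nat.mod_eq_of_lt h]; exact abs_bumpN_succ_sub_le hn h
  · have hr1 : r + 1 = n := le_antisymm (Nat.succ_le_of_lt hr) h
    have hr2 : r = n - 1 := by omega
    rw [hr1, Nat.mod_self, hr2]
    have h0 := bumpN_zero_le hn
    have hl := bumpN_last_le hn
    have h0' := bumpN_nonneg hn (show 0 < n by omega)
    have hl' := bumpN_nonneg hn (show n - 1 < n by omega)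
    rw [abs_le]; constructor <;> linarith

/-- at a block face the NEXT value is the small end value: `(r+1) mod n = 0 ⇒ β̃((r+1) mod n) ≤ 6/n`. [cite: Balaban1984PropagatorsI, p.25 (positivity of Q′G′Q′*); bookkeeping] -/
theorem bumpN_step_face_le (hn : 1 ≤ n) {r : ℕ} (h0 : (r + 1) % n = 0) : bumpN n ((r + 1) % n) ≤ 6 / n := by
  rw [h0]; exact bumpN_zero_le hn

end Profile

/-! ## §2. In-block coordinates on the fine torus `Site P 0` and the unit shifts -/

section Blocks

variable (P : Params)

/-- `n = L^K`: fine sites per block edge (`B^K(y)` has `n^d` points; `ε⁻¹ = n`). [cite: Balaban1984PropagatorsII, (2.1) p.224; Balaban1987RG1, (0.3) p.252] -/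
def nB : ℕ := P.L ^ P.K

/-- `n ≥ 1`. [cite: Balaban1987RG1, (0.3) p.252; bookkeeping] -/
theorem nB_pos : 0 < nB P := pow_pos P.L_pos _

/-- `n > 1` (`L > 1`, `K ≥ 1`). [cite: Balaban1987RG1, (0.3) p.252; bookkeeping] -/
theorem one_lt_nB (hK : 1 ≤ P.K) : 1 < nB P := by
  unfold nB
  calc 1 = 1 ^ P.K := (one_pow _).symm
    _ < P.L ^ P.K := Nat.pow_lt_pow_left P.hL.2 (by omega)

/-- `|T_ε| = n·|T₁^{(K)}|` per direction. [cite: Balaban1987RG1, (0.1) p.251; bookkeeping] -/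
theorem sites0_eq : P.sitesPerDir 0 = nB P * P.sitesPerDir P.K := by
  have h := sitesPerDir_zero_eq P P.K
  rwa [lvl_of_le P (Nat.le_add_left P.K P.m)] at h

/-- `ε⁻¹ = n` (`ε = L^{−K}`). [cite: Balaban1984PropagatorsI, p.35 («ε = L^{−K}»); bookkeeping] -/
theorem inv_eps : P.eps⁻¹ = (nB P : ℝ) := by
  unfold Params.eps nB
  rw [inv_pow, inv_inv, Nat.cast_pow]

/-- `L^{−Kd}·n^d = 1`. [cite: Balaban1984PropagatorsII, (2.14) p.225; bookkeeping] -/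
theorem wQ_mul_nB_pow : wQ P P.K * ((nB P : ℝ) ^ P.d) = 1 := by
  unfold wQ nB
  rw [lvl_of_le P (Nat.le_add_left P.K P.m), Nat.cast_pow, inv_pow, ← pow_mul, ← pow_mul, mul_comm P.K P.d,
    inv_mul_cancel₀ (pow_ne_zero _ P.cast_L_pos.ne')]

/-- The in-block coordinate `r_μ(x) ∈ {0,…,n−1}` of a fine site: `x_μ mod n` (`Site.fibreEquiv`). [cite: Balaban1987RG1, (0.3) p.252; bookkeeping] -/
def rc (x : Site P 0) (μ : Fin P.d) : ℕ := (x μ).val % nB P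

/-- `r_μ(x) < n`. [cite: Balaban1987RG1, (0.3) p.252; bookkeeping] -/
theorem rc_lt (x : Site P 0) (μ : Fin P.d) : rc P x μ < nB P := Nat.mod_lt _ (nB_pos P)

/-- the shifted site agrees with `x` off the shifted coordinate. [cite: Balaban1987RG1, (0.3) p.252; bookkeeping] -/
theorem shift_apply_ne (x : Site P 0) {μ ν : Fin P.d} (h : ν ≠ μ) : (Site.shift x μ) ν = x ν := by
  unfold Site.shift; rw [Function.update_of_ne h]

/-- label of the shifted coordinate: `(x_μ + 1) mod |T_ε|`. [cite: Balaban1987RG1, (0.3) p.252; bookkeeping] -/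
theorem val_shift_self (x : Site P 0) (μ : Fin P.d) : ((Site.shift x μ) μ).val = ((x μ).val + 1) % P.sitesPerDir 0 := by
  unfold Site.shift
  rw [Function.update_self, ZMod.val_add, ZMod.val_one]

/-- **`r_μ(x + e_μ) = (r_μ(x) + 1) mod n`** (inside the block the coordinate increases by one; across a face it returns to 0).
[cite: Balaban1987RG1, (0.3) p.252; bookkeeping] -/
theorem rc_shift_self (hK : 1 ≤ P.K) (x : Site P 0) (μ : Fin P.d) : rc P (Site.shift x μ) μ = (rc P x μ + 1) % nB P := by
  unfold rc
  rw [val_shift_self, Nat.mod_mod_of_dvd _ ⟨P.sitesPerDir P.K, sites0_eq P⟩, Nat.add_mod, Nat.mod_eq_of_lt (one_lt_nB P hK)]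

/-- the other in-block coordinates do not move. [cite: Balaban1987RG1, (0.3) p.252; bookkeeping] -/
theorem rc_shift_ne (x : Site P 0) {μ ν : Fin P.d} (h : ν ≠ μ) : rc P (Site.shift x μ) ν = rc P x ν := by
  unfold rc; rw [shift_apply_ne P x h]

/-- **Interior step: the block does not change** (`r_μ(x) + 1 < n ⇒ B^K(x + e_μ) = B^K(x)`). [cite: Balaban1987RG1, (0.3) p.252; bookkeeping] -/
theorem proj_shift_of_lt (hK : 1 ≤ P.K) (x : Site P 0) (μ : Fin P.d) (h : rc P x μ + 1 < nB P) :
    Site.proj P.K P.K (Site.shift x μ) = Site.proj P.K P.K x := by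
  have h0 := sites0_eq P
  funext ν
  apply ZMod.val_injective
  rw [Site.val_proj h0, Site.val_proj h0]
  by_cases hν : ν = μ
  · subst hν
    rw [val_shift_self]
    set a := (x ν).val with ha
    have haN : a < P.sitesPerDir 0 := ZMod.val_lt _
    have hrc : a % nB P + 1 < nB P := h
    have h2 : (a + 1) % nB P = a % nB P + 1 := by
      rw [Nat.add_mod, Nat.mod_eq_of_lt (one_lt_nB P hK), Nat.mod_eq_of_lt hrc]
    have hndvd' : ¬ (nB P ∣ a + 1) := fun hd => by
      have := Nat.mod_eq_zero_of_dvd hd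
      omega
    have hlt : a + 1 < P.sitesPerDir 0 := by
      rcases (Nat.succ_le_of_lt haN).lt_or_eq with hlt | heq
      · exact hlt
      · exact absurd ⟨P.sitesPerDir P.K, heq.trans h0⟩ hndvd'
    rw [Nat.mod_eq_of_lt hlt]
    show (a + 1) / nB P = a / nB P
    rw [Nat.succ_div, if_neg hndvd', add_zero]
  · rw [shift_apply_ne P x hν]

/-- **Face step**: `r_μ(x) + 1 = n ⇒ r_μ(x + e_μ) = 0`. [cite: Balaban1987RG1, (0.3) p.252; bookkeeping] -/
theorem rc_shift_eq_zero (hK : 1 ≤ P.K) (x : Site P 0) (μ : Fin P.d) (h : rc P x μ + 1 = nB P) : rc P (Site.shift x μ) μ = 0 := by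
  rw [rc_shift_self P hK, h, Nat.mod_self]

/-- The DICHOTOMY used for the energy: either the block is unchanged or the new in-block coordinate is 0.
[cite: Balaban1987RG1, (0.3) p.252; bookkeeping] -/
theorem proj_shift_or (hK : 1 ≤ P.K) (x : Site P 0) (μ : Fin P.d) :
    Site.proj P.K P.K (Site.shift x μ) = Site.proj P.K P.K x ∨ rc P (Site.shift x μ) μ = 0 := by
  rcases Nat.lt_or_ge (rc P x μ + 1) (nB P) with h | h
  · exact Or.inl (proj_shift_of_lt P hK x μ h)
  · exact Or.inr (rc_shift_eq_zero P hK x μ (le_antisymm (Nat.succ_le_of_lt (rc_lt P x μ)) h))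

/-- The unit shift as a bijection of the torus (inverse `Site.unshift`); sums over `T_ε` are shift invariant (cf. the landed
`B5CombesThomasTorus.sum_shift`, not imported here to keep the import cone small). [cite: Balaban1987RG1, (0.3) p.252; bookkeeping] -/
def shiftEquiv (μ : Fin P.d) : Site P 0 ≃ Site P 0 where
  toFun x := Site.shift x μ
  invFun x := Site.unshift x μ
  left_inv x := by simp [Site.shift, Site.unshift]
  right_inv x := by simp [Site.shift, Site.unshift]

end Blocks

/-! ## §3. The block bump `b(x) = Π_μ β̃(r_μ(x))`, block sums, and the test map `Tλ = λ(y(x))·b(x)` with `Q′_KT = I` EXACTLY -/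

section Bump

variable (P : Params)

/-- `1 ≤ n`. [cite: Balaban1987RG1, (0.3) p.252; bookkeeping] -/
theorem one_le_nB : 1 ≤ nB P := nB_pos P

/-- **The block bump** `b(x) = Π_μ β̃(r_μ(x))` on the fine torus (a discrete bump on every block `B^K(y)`, small near the block faces).
[cite: Balaban1984PropagatorsI, p.25 (positivity of Q′G′Q′*); bookkeeping] -/
def bump (x : Site P 0) : ℝ := ∏ μ, bumpN (nB P) (rc P x μ)

/-- `b ≥ 0`. [cite: Balaban1984PropagatorsI, p.25 (positivity of Q′G′Q′*); bookkeeping] -/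
theorem bump_nonneg (x : Site P 0) : 0 ≤ bump P x :=
  Finset.prod_nonneg fun μ _ => bumpN_nonneg (one_le_nB P) (rc_lt P x μ)

/-- `b ≤ (3/2)^d`. [cite: Balaban1984PropagatorsI, p.25; bookkeeping] -/
theorem bump_le (x : Site P 0) : bump P x ≤ (3 / 2 : ℝ) ^ P.d := by
  unfold bump
  calc ∏ μ, bumpN (nB P) (rc P x μ) ≤ ∏ _μ : Fin P.d, (3 / 2 : ℝ) :=
        Finset.prod_le_prod (fun μ _ => bumpN_nonneg (one_le_nB P) (rc_lt P x μ)) fun μ _ => bumpN_le (one_le_nB P) _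
    _ = (3 / 2 : ℝ) ^ P.d := by rw [Finset.prod_const, Finset.card_univ, Fintype.card_fin]

/-- partial products of the profile are nonnegative. [folklore] -/
private theorem prod_erase_nonneg (x : Site P 0) (μ : Fin P.d) : 0 ≤ ∏ ν ∈ Finset.univ.erase μ, bumpN (nB P) (rc P x ν) :=
  Finset.prod_nonneg fun ν _ => bumpN_nonneg (one_le_nB P) (rc_lt P x ν)

/-- partial products of the profile are `≤ (3/2)^d`. [folklore] -/
private theorem prod_erase_le (x : Site P 0) (μ : Fin P.d) : ∏ ν ∈ Finset.univ.erase μ, bumpN (nB P) (rc P x ν) ≤ (3 / 2 : ℝ) ^ P.d :=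
  calc ∏ ν ∈ Finset.univ.erase μ, bumpN (nB P) (rc P x ν) ≤ ∏ _ν ∈ Finset.univ.erase μ, (3 / 2 : ℝ) :=
        Finset.prod_le_prod (fun ν _ => bumpN_nonneg (one_le_nB P) (rc_lt P x ν)) fun ν _ => bumpN_le (one_le_nB P) _
    _ = (3 / 2 : ℝ) ^ (Finset.univ.erase μ).card := Finset.prod_const _
    _ ≤ (3 / 2 : ℝ) ^ P.d := pow_le_pow_right₀ (by norm_num) (by
        rw [Finset.card_erase_of_mem (Finset.mem_univ μ), Finset.card_univ, Fintype.card_fin]; omega)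

/-- `b(x) = β̃(r_μ(x))·Π_{ν≠μ} β̃(r_ν(x))`. [cite: Balaban1984PropagatorsI, p.25 (positivity of Q′G′Q′*); bookkeeping] -/
theorem bump_eq_mul (x : Site P 0) (μ : Fin P.d) :
    bump P x = bumpN (nB P) (rc P x μ) * ∏ ν ∈ Finset.univ.erase μ, bumpN (nB P) (rc P x ν) :=
  (Finset.mul_prod_erase _ _ (Finset.mem_univ μ)).symm

/-- `b(x + e_μ) = β̃((r_μ(x)+1) mod n)·Π_{ν≠μ} β̃(r_ν(x))`. [cite: Balaban1984PropagatorsI, p.25; bookkeeping] -/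
theorem bump_shift_eq (hK : 1 ≤ P.K) (x : Site P 0) (μ : Fin P.d) :
    bump P (Site.shift x μ) = bumpN (nB P) ((rc P x μ + 1) % nB P) * ∏ ν ∈ Finset.univ.erase μ, bumpN (nB P) (rc P x ν) := by
  rw [bump_eq_mul P (Site.shift x μ) μ, rc_shift_self P hK]
  congr 1
  exact Finset.prod_congr rfl fun ν hν => by rw [rc_shift_ne P x (Finset.ne_of_mem_erase hν)]

/-- **`|b(x + e_μ) − b(x)| ≤ (6/n)(3/2)^d`** everywhere (interior steps and face crossings alike). [cite: Balaban1984PropagatorsI, p.25; bookkeeping] -/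
theorem abs_bump_shift_sub_le (hK : 1 ≤ P.K) (x : Site P 0) (μ : Fin P.d) :
    |bump P (Site.shift x μ) - bump P x| ≤ 6 / (nB P : ℝ) * (3 / 2 : ℝ) ^ P.d := by
  rw [bump_shift_eq P hK, bump_eq_mul P x μ, ← sub_mul, abs_mul, abs_of_nonneg (prod_erase_nonneg P x μ)]
  exact mul_le_mul (abs_bumpN_step_le (one_le_nB P) (rc_lt P x μ)) (prod_erase_le P x μ) (prod_erase_nonneg P x μ)
    (by positivity)

/-- **at a face the bump is small on the far side**: `r_μ(x + e_μ) = 0 ⇒ b(x + e_μ) ≤ (6/n)(3/2)^d`. [cite: Balaban1984PropagatorsI, p.25; bookkeeping] -/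
theorem bump_shift_face_le (hK : 1 ≤ P.K) (x : Site P 0) (μ : Fin P.d) (h0 : rc P (Site.shift x μ) μ = 0) :
    bump P (Site.shift x μ) ≤ 6 / (nB P : ℝ) * (3 / 2 : ℝ) ^ P.d := by
  rw [bump_shift_eq P hK]
  have h0' : (rc P x μ + 1) % nB P = 0 := by rwa [rc_shift_self P hK] at h0
  exact mul_le_mul (bumpN_step_face_le (one_le_nB P) h0') (prod_erase_le P x μ) (prod_erase_nonneg P x μ) (by positivity)

/-- **Block sums factorise**: `Σ_{x ∈ B^K(y)} Π_μ g(r_μ(x)) = (Σ_{r<n} g(r))^d` (`Site.fibreEquiv`: `B^K(y) ≃ {0,…,n−1}^d`).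
[cite: Balaban1987RG1, (0.3) p.252; bookkeeping] -/
theorem sum_block_prod (g : ℕ → ℝ) (y : Site P P.K) :
    ∑ x ∈ Finset.univ.filter (fun x : Site P 0 => Site.proj P.K P.K x = y), ∏ μ, g (rc P x μ) =
      (∑ r ∈ Finset.range (nB P), g r) ^ P.d := by
  have h0 := sites0_eq P
  show _ = (∑ r ∈ Finset.range (P.L ^ P.K), g r) ^ P.d
  rw [Finset.sum_subtype (Finset.univ.filter fun x : Site P 0 => Site.proj P.K P.K x = y)
      (p := fun x : Site P 0 => Site.proj P.K P.K x = y) (fun x => by simp)]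
  calc ∑ x : {x : Site P 0 // Site.proj P.K P.K x = y}, ∏ μ, g (rc P x.1 μ)
      = ∑ r : Fin P.d → Fin (P.L ^ P.K), ∏ μ, g (r μ : ℕ) :=
        Fintype.sum_equiv (Site.fibreEquiv h0 y) (fun x => ∏ μ, g (rc P x.1 μ)) (fun r => ∏ μ, g (r μ : ℕ)) (fun x => rfl)
    _ = ∏ _μ : Fin P.d, ∑ s : Fin (P.L ^ P.K), g (s : ℕ) :=
        (Fintype.prod_sum (fun (_ : Fin P.d) (s : Fin (P.L ^ P.K)) => g (s : ℕ))).symm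
    _ = (∑ r ∈ Finset.range (P.L ^ P.K), g r) ^ P.d := by
        rw [Finset.prod_const, Finset.card_univ, Fintype.card_fin, Fin.sum_univ_eq_sum_range (fun r => g r) (P.L ^ P.K)]

/-- **`Σ_{x ∈ B^K(y)} b(x) = n^d`** (exact normalisation of the bump). [cite: Balaban1984PropagatorsI, p.25; bookkeeping] -/
theorem sum_block_bump (y : Site P P.K) :
    ∑ x ∈ Finset.univ.filter (fun x : Site P 0 => Site.proj P.K P.K x = y), bump P x = (nB P : ℝ) ^ P.d := by
  unfold bump
  rw [sum_block_prod P (bumpN (nB P)) y, sum_bumpN (one_le_nB P)]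

/-- `|B^K(y)| = n^d`. [cite: Balaban1987RG1, (0.3) p.252] -/
theorem card_block (y : Site P P.K) : (Finset.univ.filter (fun x : Site P 0 => Site.proj P.K P.K x = y)).card = nB P ^ P.d :=
  Site.card_fibre (sites0_eq P) y

/-- **The test map** `(Tλ)(x) = λ(y(x))·b(x)` (`x ∈ B^K(y(x))`): a bump right inverse of `Q′_K`. [cite: Balaban1984PropagatorsI, p.25; bookkeeping] -/
def testT (lam : Site P P.K → ℝ) (x : Site P 0) : ℝ := lam (Site.proj P.K P.K x) * bump P x

/-- `L^{−Kd}·n^d = 1` in the form used by `Qk_mulVec`. [cite: Balaban1984PropagatorsII, (2.14) p.225; bookkeeping] -/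
theorem w_mul_nB_pow : (((P.L : ℝ) ^ P.d)⁻¹) ^ P.K * ((nB P : ℝ) ^ P.d) = 1 := by
  have h := wQ_mul_nB_pow P
  unfold wQ at h
  rwa [lvl_of_le P (Nat.le_add_left P.K P.m)] at h

/-- **`Q′_KT = I` EXACTLY**: `(Q_K(Tλ))(y) = L^{−Kd}Σ_{x∈B^K(y)} λ(y)b(x) = λ(y)`. [cite: Balaban1984PropagatorsI, p.25; Balaban1984PropagatorsII, (2.14) p.225] -/
theorem Qk_testT (lam : Site P P.K → ℝ) : Qk P P.K *ᵥ testT P lam = lam := by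
  funext y
  have hKle : P.K ≤ P.m + P.K := Nat.le_add_left _ _
  have h := B1RG242Torus.Qk_mulVec (P := P) 0 0 hKle (testT P lam) y
  have hsum : ∑ x ∈ Finset.univ.filter (fun x : Site P 0 => Site.proj P.K P.K x = y), testT P lam x =
      lam y * (nB P : ℝ) ^ P.d := by
    rw [← sum_block_bump P y, Finset.mul_sum]
    refine Finset.sum_congr rfl fun x hx => ?_
    unfold testT
    rw [(Finset.mem_filter.mp hx).2]
  change ((tower P 0 0).Qk P.K *ᵥ testT P lam) y = lam y
  rw [h, hsum, mul_left_comm, w_mul_nB_pow, mul_one]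

end Bump

/-! ## §4. The energy `⟨Tλ, Δ′Tλ⟩ ≤ C_q·n^d‖λ‖²` -/

section Energy

variable (P : Params)

/-- `N₀(λ) = Σ_x λ(y(x))²` (`= n^d‖λ‖²`). [cite: Balaban1984PropagatorsI, p.25; bookkeeping] -/
def N0 (lam : Site P P.K → ℝ) : ℝ := ∑ x : Site P 0, lam (Site.proj P.K P.K x) ^ 2

/-- `N₀(λ) ≥ 0`. [cite: Balaban1984PropagatorsI, p.25 (positivity of Q′G′Q′*); bookkeeping] -/
theorem N0_nonneg (lam : Site P P.K → ℝ) : 0 ≤ N0 P lam := Finset.sum_nonneg fun _ _ => sq_nonneg _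

/-- `N₀(λ) = n^d‖λ‖²`. [cite: Balaban1987RG1, (0.3) p.252; bookkeeping] -/
theorem N0_eq (lam : Site P P.K → ℝ) : N0 P lam = (nB P : ℝ) ^ P.d * (lam ⬝ᵥ lam) := by
  unfold N0
  rw [← Finset.sum_fiberwise Finset.univ (Site.proj P.K P.K) (fun x : Site P 0 => lam (Site.proj P.K P.K x) ^ 2), dotProduct,
    Finset.mul_sum]
  refine Finset.sum_congr rfl fun y _ => ?_
  rw [Finset.sum_congr rfl (g := fun _ => lam y ^ 2) (fun x hx => by rw [(Finset.mem_filter.mp hx).2]), Finset.sum_const,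
    card_block, nsmul_eq_mul, Nat.cast_pow]
  ring

/-- `‖Tλ‖² ≤ (3/2)^{2d}·N₀(λ)`. [cite: Balaban1984PropagatorsI, p.25; bookkeeping] -/
theorem testT_dot_self_le (lam : Site P P.K → ℝ) : testT P lam ⬝ᵥ testT P lam ≤ ((3 / 2 : ℝ) ^ P.d) ^ 2 * N0 P lam := by
  unfold N0
  rw [dotProduct, Finset.mul_sum]
  refine Finset.sum_le_sum fun x _ => ?_
  unfold testT
  have hb2 : bump P x ^ 2 ≤ ((3 / 2 : ℝ) ^ P.d) ^ 2 := pow_le_pow_left₀ (bump_nonneg P x) (bump_le P x) 2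
  calc lam (Site.proj P.K P.K x) * bump P x * (lam (Site.proj P.K P.K x) * bump P x)
      = lam (Site.proj P.K P.K x) ^ 2 * bump P x ^ 2 := by ring
    _ ≤ lam (Site.proj P.K P.K x) ^ 2 * ((3 / 2 : ℝ) ^ P.d) ^ 2 := mul_le_mul_of_nonneg_left hb2 (sq_nonneg _)
    _ = ((3 / 2 : ℝ) ^ P.d) ^ 2 * lam (Site.proj P.K P.K x) ^ 2 := mul_comm _ _

/-- **the one-step difference of `Tλ`**: `|Tλ(x+e_μ) − Tλ(x)| ≤ (6/n)(3/2)^d(|λ(y(x+e_μ))| + 2|λ(y(x))|)` — inside a block only the bump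
moves (by ≤ 6/n per step), across a face both bump values are ≤ 6/n. [cite: Balaban1984PropagatorsI, p.25; bookkeeping] -/
theorem abs_testT_shift_sub_le (hK : 1 ≤ P.K) (lam : Site P P.K → ℝ) (x : Site P 0) (μ : Fin P.d) :
    |testT P lam (Site.shift x μ) - testT P lam x| ≤
      6 / (nB P : ℝ) * (3 / 2 : ℝ) ^ P.d * (|lam (Site.proj P.K P.K (Site.shift x μ))| + 2 * |lam (Site.proj P.K P.K x)|) := by
  set C := 6 / (nB P : ℝ) * (3 / 2 : ℝ) ^ P.d with hC
  have hC0 : 0 ≤ C := by positivity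
  set p' := Site.proj P.K P.K (Site.shift x μ) with hp'
  set p := Site.proj P.K P.K x with hp
  have hdecomp : testT P lam (Site.shift x μ) - testT P lam x =
      (lam p' - lam p) * bump P (Site.shift x μ) + lam p * (bump P (Site.shift x μ) - bump P x) := by
    unfold testT; ring
  have h1 : |(lam p' - lam p) * bump P (Site.shift x μ)| ≤ (|lam p'| + |lam p|) * C := by
    rcases proj_shift_or P hK x μ with h | h
    · have h0 : lam p' - lam p = 0 := by rw [hp', hp, h, sub_self]
      rw [h0, zero_mul, abs_zero]
      positivity
    · rw [abs_mul, abs_of_nonneg (bump_nonneg P _)]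
      exact mul_le_mul (abs_sub _ _) (bump_shift_face_le P hK x μ h) (bump_nonneg P _) (by positivity)
  have h2 : |lam p * (bump P (Site.shift x μ) - bump P x)| ≤ |lam p| * C := by
    rw [abs_mul]
    exact mul_le_mul_of_nonneg_left (abs_bump_shift_sub_le P hK x μ) (abs_nonneg _)
  rw [hdecomp]
  calc |(lam p' - lam p) * bump P (Site.shift x μ) + lam p * (bump P (Site.shift x μ) - bump P x)|
      ≤ |(lam p' - lam p) * bump P (Site.shift x μ)| + |lam p * (bump P (Site.shift x μ) - bump P x)| := abs_add_le _ _
    _ ≤ (|lam p'| + |lam p|) * C + |lam p| * C := add_le_add h1 h2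
    _ = C * (|lam p'| + 2 * |lam p|) := by ring

/-- **`‖∂^ε_μTλ‖² ≤ 360·(3/2)^{2d}·N₀(λ)`** (`ε⁻¹ = n` cancels the `6/n`; shift invariance of `Σ_x`). [cite: Balaban1984PropagatorsI, p.25; bookkeeping] -/
theorem deriv_testT_sq_le (hK : 1 ≤ P.K) (lam : Site P P.K → ℝ) (μ : Fin P.d) :
    (deriv P 0 P.eps μ *ᵥ testT P lam) ⬝ᵥ (deriv P 0 P.eps μ *ᵥ testT P lam) ≤ 360 * ((3 / 2 : ℝ) ^ P.d) ^ 2 * N0 P lam := by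
  set C := (3 / 2 : ℝ) ^ P.d with hC
  have hn : (0 : ℝ) < nB P := by exact_mod_cast nB_pos P
  have hpt : ∀ x : Site P 0, (deriv P 0 P.eps μ *ᵥ testT P lam) x * (deriv P 0 P.eps μ *ᵥ testT P lam) x ≤
      36 * C ^ 2 * (2 * lam (Site.proj P.K P.K (Site.shift x μ)) ^ 2 + 8 * lam (Site.proj P.K P.K x) ^ 2) := by
    intro x
    rw [deriv_mulVec, inv_eps]
    set a' := lam (Site.proj P.K P.K (Site.shift x μ))
    set b' := lam (Site.proj P.K P.K x)
    have h := abs_testT_shift_sub_le P hK lam x μ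
    have h' : |(nB P : ℝ) * (testT P lam (Site.shift x μ) - testT P lam x)| ≤ 6 * C * (|a'| + 2 * |b'|) := by
      rw [abs_mul, abs_of_pos hn]
      calc (nB P : ℝ) * |testT P lam (Site.shift x μ) - testT P lam x|
          ≤ (nB P : ℝ) * (6 / (nB P : ℝ) * C * (|a'| + 2 * |b'|)) := mul_le_mul_of_nonneg_left h hn.le
        _ = 6 * C * (|a'| + 2 * |b'|) := by field_simp
    have hsq := pow_le_pow_left₀ (abs_nonneg _) h' 2
    rw [sq_abs] at hsq
    have hq : (|a'| + 2 * |b'|) ^ 2 ≤ 2 * a' ^ 2 + 8 * b' ^ 2 := by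
      nlinarith [sq_nonneg (|a'| - 2 * |b'|), sq_abs a', sq_abs b']
    have hC2 : 0 ≤ (6 * C) ^ 2 := sq_nonneg _
    calc (nB P : ℝ) * (testT P lam (Site.shift x μ) - testT P lam x) * ((nB P : ℝ) * (testT P lam (Site.shift x μ) - testT P lam x))
        = ((nB P : ℝ) * (testT P lam (Site.shift x μ) - testT P lam x)) ^ 2 := by ring
      _ ≤ (6 * C * (|a'| + 2 * |b'|)) ^ 2 := hsq
      _ = (6 * C) ^ 2 * (|a'| + 2 * |b'|) ^ 2 := by ring
      _ ≤ (6 * C) ^ 2 * (2 * a' ^ 2 + 8 * b' ^ 2) := mul_le_mul_of_nonneg_left hq hC2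
      _ = 36 * C ^ 2 * (2 * a' ^ 2 + 8 * b' ^ 2) := by ring
  calc (deriv P 0 P.eps μ *ᵥ testT P lam) ⬝ᵥ (deriv P 0 P.eps μ *ᵥ testT P lam)
      ≤ ∑ x : Site P 0, 36 * C ^ 2 * (2 * lam (Site.proj P.K P.K (Site.shift x μ)) ^ 2 + 8 * lam (Site.proj P.K P.K x) ^ 2) :=
        Finset.sum_le_sum fun x _ => hpt x
    _ = 36 * C ^ 2 * (2 * ∑ x : Site P 0, lam (Site.proj P.K P.K (Site.shift x μ)) ^ 2 + 8 * N0 P lam) := by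
        unfold N0
        rw [← Finset.mul_sum, Finset.sum_add_distrib, ← Finset.mul_sum, ← Finset.mul_sum]
    _ = 360 * C ^ 2 * N0 P lam := by
        rw [Fintype.sum_equiv (shiftEquiv P μ) (fun x => lam (Site.proj P.K P.K (Site.shift x μ)) ^ 2)
          (fun x => lam (Site.proj P.K P.K x) ^ 2) (fun _ => rfl)]
        unfold N0
        ring

/-- `⟨Tλ, Q*_KQ_K Tλ⟩ = ⟨Tλ, Q*_Kλ⟩ = Σ_x λ(y(x))²b(x) ∈ [0, (3/2)^d N₀(λ)]`. [cite: Balaban1984PropagatorsI, p.25; bookkeeping] -/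
theorem testT_QksQk_le (lam : Site P P.K → ℝ) :
    testT P lam ⬝ᵥ ((Qks P P.K * Qk P P.K) *ᵥ testT P lam) ≤ (3 / 2 : ℝ) ^ P.d * N0 P lam ∧
      0 ≤ testT P lam ⬝ᵥ ((Qks P P.K * Qk P P.K) *ᵥ testT P lam) := by
  have hKle : P.K ≤ P.m + P.K := Nat.le_add_left _ _
  have hQks : ∀ x, (Qks P P.K *ᵥ lam) x = lam (Site.proj P.K P.K x) := fun x => B1RG242Torus.Qks_mulVec (P := P) 0 0 hKle lam x
  rw [← Matrix.mulVec_mulVec, Qk_testT]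
  unfold N0
  rw [dotProduct, Finset.mul_sum]
  constructor
  · refine Finset.sum_le_sum fun x _ => ?_
    rw [hQks]
    unfold testT
    have hb := bump_le P x
    have h0 := sq_nonneg (lam (Site.proj P.K P.K x))
    calc lam (Site.proj P.K P.K x) * bump P x * lam (Site.proj P.K P.K x) = lam (Site.proj P.K P.K x) ^ 2 * bump P x := by ring
      _ ≤ lam (Site.proj P.K P.K x) ^ 2 * (3 / 2 : ℝ) ^ P.d := mul_le_mul_of_nonneg_left hb h0
      _ = (3 / 2 : ℝ) ^ P.d * lam (Site.proj P.K P.K x) ^ 2 := mul_comm _ _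
  · refine Finset.sum_nonneg fun x _ => ?_
    rw [hQks]
    unfold testT
    have hb := bump_nonneg P x
    have h0 := sq_nonneg (lam (Site.proj P.K P.K x))
    calc (0 : ℝ) ≤ lam (Site.proj P.K P.K x) ^ 2 * bump P x := mul_nonneg h0 hb
      _ = lam (Site.proj P.K P.K x) * bump P x * lam (Site.proj P.K P.K x) := by ring

/-- **The uniform constant** `C_q(d, a, m²) = m²(3/2)^{2d} + 360d(3/2)^{2d} + a(3/2)^d`. [cite: Balaban1984PropagatorsI, p.25; bookkeeping] -/
def Cq (d : ℕ) (a msq : ℝ) : ℝ := msq * ((3 / 2 : ℝ) ^ d) ^ 2 + (d : ℝ) * (360 * ((3 / 2 : ℝ) ^ d) ^ 2) + a * (3 / 2 : ℝ) ^ d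

/-- `C_q > 0`. [cite: Balaban1984PropagatorsI, p.25 (positivity of Q′G′Q′*); bookkeeping] -/
theorem Cq_pos (d : ℕ) {a msq : ℝ} (ha : 0 < a) (hm : 0 ≤ msq) : 0 < Cq d a msq := by
  unfold Cq; positivity

/-- **THE ENERGY BOUND** `⟨Tλ, Δ′Tλ⟩ = m²‖Tλ‖² + Σ_μ‖∂^ε_μTλ‖² + a_K⟨Tλ, Q*_KQ_KTλ⟩ ≤ C_q·N₀(λ) = C_q·n^d‖λ‖²` (`a_K ≤ a`).
[cite: Balaban1984PropagatorsI, p.25; Balaban1984PropagatorsII, (2.13) p.225] -/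
theorem energy_le (hK : 1 ≤ P.K) {a msq : ℝ} (ha : 0 < a) (hm : 0 ≤ msq) (lam : Site P P.K → ℝ) :
    testT P lam ⬝ᵥ (deltaPrimeK P a msq *ᵥ testT P lam) ≤ Cq P.d a msq * N0 P lam := by
  unfold deltaPrimeK
  rw [Matrix.add_mulVec, dotProduct_add, Matrix.smul_mulVec, dotProduct_smul, smul_eq_mul, form_hOp]
  obtain ⟨h3, h3'⟩ := testT_QksQk_le P lam
  have h1 := testT_dot_self_le P lam
  have h2 : ∑ μ, (deriv P 0 P.eps μ *ᵥ testT P lam) ⬝ᵥ (deriv P 0 P.eps μ *ᵥ testT P lam) ≤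
      (P.d : ℝ) * (360 * ((3 / 2 : ℝ) ^ P.d) ^ 2 * N0 P lam) :=
    calc ∑ μ, (deriv P 0 P.eps μ *ᵥ testT P lam) ⬝ᵥ (deriv P 0 P.eps μ *ᵥ testT P lam)
        ≤ ∑ _μ : Fin P.d, 360 * ((3 / 2 : ℝ) ^ P.d) ^ 2 * N0 P lam := Finset.sum_le_sum fun μ _ => deriv_testT_sq_le P hK lam μ
      _ = (P.d : ℝ) * (360 * ((3 / 2 : ℝ) ^ P.d) ^ 2 * N0 P lam) := by
          rw [Finset.sum_const, Finset.card_univ, Fintype.card_fin, nsmul_eq_mul]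
  have hL1 : (1 : ℝ) < P.L := Nat.one_lt_cast.mpr P.hL.2
  have haK : B1.aSeq a P.L P.K ≤ a := B1.aSeq_le ha hL1 P.K hK
  have haK0 : 0 ≤ B1.aSeq a P.L P.K := (B1.aSeq_pos ha hL1 hK).le
  have hN0 := N0_nonneg P lam
  have hC0 : 0 ≤ (3 / 2 : ℝ) ^ P.d * N0 P lam := by positivity
  have e1 : msq * (testT P lam ⬝ᵥ testT P lam) ≤ msq * (((3 / 2 : ℝ) ^ P.d) ^ 2 * N0 P lam) := mul_le_mul_of_nonneg_left h1 hm
  have e3 : B1.aSeq a P.L P.K * (testT P lam ⬝ᵥ ((Qks P P.K * Qk P P.K) *ᵥ testT P lam)) ≤ a * ((3 / 2 : ℝ) ^ P.d * N0 P lam) :=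
    (mul_le_mul_of_nonneg_left h3 haK0).trans (mul_le_mul_of_nonneg_right haK hC0)
  unfold Cq
  linarith

/-- `⟨v, Δ′v⟩ ≥ 0`. [cite: Balaban1984PropagatorsII, (2.13) p.225; bookkeeping] -/
theorem form_deltaPrimeK_nonneg {a msq : ℝ} (ha : 0 < a) (hm : 0 ≤ msq) (hK : 1 ≤ P.K) (v : Site P 0 → ℝ) :
    0 ≤ v ⬝ᵥ (deltaPrimeK P a msq *ᵥ v) := by
  unfold deltaPrimeK
  rw [Matrix.add_mulVec, dotProduct_add, Matrix.smul_mulVec, dotProduct_smul, smul_eq_mul]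
  have hL1 : (1 : ℝ) < P.L := Nat.one_lt_cast.mpr P.hL.2
  refine add_nonneg (form_hOp_nonneg _ hm v) (mul_nonneg (B1.aSeq_pos ha hL1 hK).le ?_)
  rw [← Matrix.mulVec_mulVec, Matrix.dotProduct_mulVec, ← Matrix.mulVec_transpose, Qk_eq_smul_transpose, Matrix.smul_mulVec,
    dotProduct_smul, smul_eq_mul]
  exact mul_nonneg (wQ_pos P P.K).le (Finset.sum_nonneg fun i _ => mul_self_nonneg _)

end Energy

/-! ## §5. Uniform coercivity of `Q′_KG′_KQ′_K*`; Proposition 2.3 and the triple Lemma 2.1 ∧ Prop 2.2 ∧ Prop 2.3 hypothesis-free -/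

section Coercive

variable (P : Params)

/-- **`Q′_KG′_KQ′_K* ≥ 1/C_q` ON EVERY VOLUME** (K ≥ 1, a > 0, m² ≥ 0), by the variational principle
`QGQInverse.qgq_coercive_of_approx_right_inverse` with the EXACT bump right inverse `T` (θ = 0) and the energy bound (`energy_le`);
the conversion `Q_Kᵀ = L^{−Kd}Q_K*`, `L^{−Kd}n^d = 1` makes the constant volume- and K-independent.
[cite: Balaban1984PropagatorsI, p.25 (after (1.44)); Balaban1984PropagatorsII, p.235] -/
theorem coercive_qgq (hK : 1 ≤ P.K) {a msq : ℝ} (ha : 0 < a) (hm : 0 ≤ msq) :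
    Coercive (Qk P P.K * (tower P a msq).G P.K * Qks P P.K) (1 / Cq P.d a msq) := by
  have hsymm : (deltaPrimeK P a msq).IsSymm := deltaPrimeK_transpose P a msq
  have hunit := deltaPrimeK_isUnit P ha hm hK
  have hpos := form_deltaPrimeK_nonneg P ha hm hK
  have hnpow : (0 : ℝ) < (nB P : ℝ) ^ P.d := pow_pos (by exact_mod_cast nB_pos P) _
  have hCq := Cq_pos P.d ha hm
  have hco := qgq_coercive_of_approx_right_inverse (deltaPrimeK P a msq) hsymm hunit hpos (Qk P P.K)
      (θ := 0) (C := Cq P.d a msq * (nB P : ℝ) ^ P.d) (by positivity) (by norm_num) (testT P)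
      (fun lam => by rw [Qk_testT, sub_zero, one_mul])
      (fun lam => by rw [mul_assoc, ← N0_eq]; exact energy_le P hK ha hm lam)
  intro v
  have h := hco v
  have hG : (deltaPrimeK P a msq)⁻¹ = (tower P a msq).G P.K := (G_eq_inv P ha hm hK).symm
  have hT : (Qk P P.K)ᵀ = wQ P P.K • Qks P P.K := by
    rw [Qk_eq_smul_transpose, Matrix.transpose_smul, Matrix.transpose_transpose]
  rw [hG, hT, Matrix.mul_smul, Matrix.smul_mulVec, dotProduct_smul, smul_eq_mul, sub_zero, one_pow] at h
  have hw := wQ_pos P P.K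
  have hwn : wQ P P.K * (nB P : ℝ) ^ P.d = 1 := wQ_mul_nB_pow P
  have hvv : 0 ≤ v ⬝ᵥ v := Finset.sum_nonneg fun i _ => mul_self_nonneg _
  -- 1/C_q = w · 1/(C_q n^d w)… : divide `h` by w
  have e : 1 / Cq P.d a msq * (v ⬝ᵥ v) = (1 / (Cq P.d a msq * (nB P : ℝ) ^ P.d) * (v ⬝ᵥ v)) / wQ P P.K := by
    field_simp
    linear_combination (v ⬝ᵥ v) * hwn
  rw [e, div_le_iff₀ hw, mul_comm _ (wQ P P.K)]
  exact h

/-- **… hence uniformly on the one-scale tower-torus family** (`1/C_q(d, a, m²)` serves every member). [cite: Balaban1984PropagatorsI, p.25; Balaban1984PropagatorsII, p.235] -/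
theorem coercive_qgq_family (d L : ℕ) {a : ℝ} (ha : 0 < a) {msq : ℝ} (hmsq : 0 ≤ msq) (i : Index d L) :
    Coercive (Qk i.P i.P.K * (tower i.P a msq).G i.P.K * Qks i.P i.P.K) (1 / Cq d a msq) := by
  have h := coercive_qgq i.P i.hK ha hmsq
  rwa [i.hPd] at h

/-- **PROPOSITION 2.3 VERBATIM ON THE ONE-SCALE TOWER-TORUS FAMILY, HYPOTHESIS-FREE**: `B6.Prop23Printed d` holds for the family
`oneScaleGeo` with the GENUINE kernel `(Q′_KG′_K²Q′_K*)⁻¹(y, y′)` (`cinvK`), for every `d ≥ 1`, odd `L > 1`, `a > 0`, `m² ≥ 0` — every member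
(every volume, K ≥ 1, Mb, R), constants uniform. Chain: bump right inverse ⇒ `Q′G′Q′* ≥ 1/C_q` (`coercive_qgq_family`) ⇒ `Q′G′²Q′* ≥ 1/C_q²`
(`coercive_qggqK_of_qgqK`) + (2.68) (`ineq268_oneScaleTorus`) ⇒ [3] Sect. 5 (`B4Sect5Torus.inv_decay`) ⇒ (2.87).
[cite: Balaban1984PropagatorsII, Prop. 2.3 (2.86)–(2.87) p.238; Balaban1983RegularityDecay, Thm. Sect. 5 p.594] -/
theorem prop23Printed_towerTorus (d L : ℕ) (hd : 1 ≤ d) (hL : Odd L ∧ 1 < L) {a : ℝ} (ha : 0 < a) {msq : ℝ} (hmsq : 0 ≤ msq) :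
    B6.Prop23Printed d (fun i : Index d L => oneScaleGeo i.P i.Mb i.R) (fun i => cinvK i.P a msq i.Mb i.R) :=
  prop23Printed_towerTorus_of_coercive_qgq d L hd hL ha hmsq (one_div_pos.mpr (Cq_pos d ha hmsq)) (coercive_qgq_family d L ha hmsq)

/-- **LEMMA 2.1 ∧ PROPOSITION 2.2 ∧ PROPOSITION 2.3 — the three verbatim census Props, GENUINE operators, ONE family, NO hypothesis**
(the one-scale tower torus: `T1` realises (2.46); `G′_K = Δ′_a⁻¹`; `(Q′_KG′_K²Q′_K*)⁻¹`): the antecedent of the edge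
`B6Ineq288Edge.ineq288_of_printed_lemma21` (p. 238 *"We have from Lemma 2.1, Proposition 2.2 and (2.87) … (2.88)"*) is inhabited.
[cite: Balaban1984PropagatorsII, Lemma 2.1 p.234, Prop. 2.2 (2.67) p.234, Prop. 2.3 (2.87) p.238, (2.88) p.238] -/
theorem lemma21_prop22_prop23_towerTorus (d L : ℕ) (hd : 1 ≤ d) (hL : Odd L ∧ 1 < L) {a : ℝ} (ha : 0 < a) {msq : ℝ}
    (hmsq : 0 ≤ msq) {δ₀ : ℝ} (hδ₀ : 0 < δ₀) :
    B6.Lemma21Printed d δ₀ (fun i : Index d L => oneScaleGeo i.P i.Mb i.R) ∧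
      B6.Prop22Printed (fun i : Index d L => oneScaleGeo i.P i.Mb i.R) (fun i => torusGp i.P a msq i.Mb i.R) ∧
      B6.Prop23Printed d (fun i : Index d L => oneScaleGeo i.P i.Mb i.R) (fun i => cinvK i.P a msq i.Mb i.R) :=
  ⟨lemma21Printed_towerTorus d L hδ₀, prop22Printed_oneScaleTorus d L hd hL ha hmsq, prop23Printed_towerTorus d L hd hL ha hmsq⟩

/- **(2.88) ON THE FAMILY, NON-VACUOUSLY**: the edge `B6Ineq288Edge.ineq288_of_printed_lemma21` instantiated with the three genuine
antecedents (its conclusion, the printed (2.88) bound for (K₁, (Q′G′²Q′*)⁻¹, K₃) with O(1) and δ₂ explicit, is the type of this term).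
[cite: Balaban1984PropagatorsII, (2.88) p.238] -/
example (d L : ℕ) (hd : 1 ≤ d) (hL : Odd L ∧ 1 < L) {a : ℝ} (ha : 0 < a) {msq : ℝ} (hmsq : 0 ≤ msq) {δ₀ : ℝ} (hδ₀ : 0 < δ₀) :=
  B6Ineq288Edge.ineq288_of_printed_lemma21 d δ₀ hδ₀.le (fun i : Index d L => oneScaleGeo i.P i.Mb i.R)
    (fun i => torusGp i.P a msq i.Mb i.R) (fun i => cinvK i.P a msq i.Mb i.R)
    (lemma21Printed_towerTorus d L hδ₀) (prop22Printed_oneScaleTorus d L hd hL ha hmsq) (prop23Printed_towerTorus d L hd hL ha hmsq)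

end Coercive

end

end Literature.MathematicalPhysics.QuantumFieldTheory.Balaban1983to89.B6QGQCoerciveTowerTorus
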